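import Summits.QuantumFields.YangMills.Theorems.BalabanUVNodesK1WindowSharpness
import Literature.MathematicalPhysics.QuantumFieldTheory.Balaban1983to89.B14Cor3

/-!
# Crux K1⁷ ∕ K2⁷ — RUNS OF EVERY LENGTH `K` NEED THE β-INPUTS AT THE LEVELS `k < K` ONLY, AND K2⁷ LINE 2's PER-SCALE ANCHOR (S2) ALONE GIVES, FOR EVERY `K`,
# A (K-DEPENDENT) COUPLING WINDOW WITH RUNS OF LENGTH `K` (flow side; at NODE 00's Stage-13 datum `Node00.datumOfRecord₁₃SepCoPH F N θ h`)

Cell `pub-ymgap`, YM-PLAN Track A (HUMAN RULING D-0062 ∕ D-0149, director-ym №197), WIDTH SEAT `pub-ymgap-dag-n13-w4` (g2) on NODE n13 [Balaban1989LargeFieldII]; helper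
(`--supports`) for crux K1⁷ `StabilityBAtRecordR13SepCoPH` = stmt-QuantumFields-20542 (window clause lineage: g0 `…K1WindowFirstStep` ∕ `…N13WindowAtRecord13SepCoPH` ∕
`…K2Line2FirstRungsAtScaleZero`; g2 `…K1WindowExactCriterion` ∕ `…K1WindowBite` ∕ `…K1WindowSharpness`).  A v1.1-IN-SUBSTANCE of `…K1WindowSharpness` §3 as a NEW importing
module (that file is at the 400-line cap).  COUNT-NEUTRAL.

TWO POINTS.
(1) `…K1WindowSharpness.ladder_of_forwardGenerated_of_firstStepGap_of_betaUpper_succ` asks the upper box bound `β k ≤ β⁺` at EVERY level `k ≥ 1`, but its induction reads it only at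
the levels `1 ≤ k < K` ((0.20) is applied `K` times).  Here the hypothesis is cut to `1 ≤ k < K` (`ladder_…_lt`, `windowK_…_lt`): a run of length `K` in `]0, γ]` costs the exact level-0
criterion and FINITELY MANY box bounds.
(2) Hence LOCAL bounds near the corner suffice for each fixed `K`: if every `β k` (`k ≥ 1`) is bounded above on SOME box `]0, γ_k]^{k+1}` (radius depending on `k`) and level `0` meets
the exact criterion, then for every `K` there is `γ_K > 0` (a finite minimum) such that every `γ ∈ ]0, γ_K]` carries runs `⟨K, m, g₀⟩` inside `]0, γ]` (`windowK_local_of_…`).  K2⁷ v4 LINE 2's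
registered S2 `stub_anchor13 : D4AnchorRecord13` («per-scale anchor»: ∀ k δ > 0 ∃ γ > 0, `|S.β1 k v| ≤ δ` on `]0,γ]^{k+1}` for the record's definitional split) supplies EXACTLY such local
bounds (`β_m k ≤ β⁰_k + 1` near the corner) AND, at `k = 0`, the window's exact criterion (a one-sided limit at `0⁺` ⟹ `g⁻² − β_m 0 (g)` unbounded above); so at the record:
★ S2 ALONE ⟹ for every `K`, `m`: `∃ γ_K > 0, ∀ γ ∈ ]0, γ_K], ∃ g₀ > 0, ((datumOfRecord₁₃SepCoPH F N θ h).C ⟨K, m, g₀⟩).flow.InInterval γ K` (`windowK_datumOfRecord₁₃SepCoPH_of_anchor`) —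
runs of EVERY length, each length in its own window (the UNIFORM-in-`K` window is what [I] p. 264's uniform bound ∕ K2⁷'s `EndpointExistence` add).  In particular S2 ⟹ K1⁷'s
window conjunct (g0's `window_datumOfRecord₁₃SepCoPH_of_anchorZero`, re-derived as the case `K = 1`).

WHAT THIS FILE PROVES (theorems only, 0 `def`, 0 `sorry`).
* §1 flow side: ★ `ladder_of_forwardGenerated_of_firstStepGap_of_betaUpper_lt` · ★ `windowK_of_forwardGenerated_of_frequently_le_of_betaUpper_lt` · `exists_common_box_upTo` (finitely
  many local box bounds ⟹ one box, one constant, below `K`) · ★★ `windowK_local_of_forwardGenerated_of_frequently_le` · `localUpper_of_anchorAt_betaOfMerged` (S2_k ⟹ `β_m k ≤ β⁰_k + 1`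
  near the corner) · `frequently_le_of_anchorZero_betaOfMerged` (S2_0 ⟹ the exact level-0 criterion) · ★★ `windowK_of_forwardGenerated_of_anchor_betaOfMerged`.
* §2 at the record (general `N`, `0 < θ.γ`): ★★ `windowK_datumOfRecord₁₃SepCoPH_of_anchor` · `window_datumOfRecord₁₃SepCoPH_of_anchor` (K1⁷'s conjunct, `K = 1`); `N = 2`:
  `windowK₂_datumOfRecord₁₃SepCoPH_of_anchor` (keyed on `θ.Admissible F 2`).
* §4 (B) BITES AT EVERY LEVEL under K-indexed windows (the bite of `…K1WindowBite`, one length at a time; proved here route-independently — no Theses import): ★ `bitesK_of_endStatementBPrinted_of_windowK` (every `B16.Construction`) ·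
  ★★ `bitesK_datumOfRecord₁₃SepCoPH_of_endStatementBPrinted_of_anchor` ((B) ∧ S2 at the record ⟹ for every `K`: in a window `]0, γ_K]` some run of length EXACTLY `K` carries §2's
  description and (2.50) at every level `k ≤ K` — so NO level is vacuous; the bare `K ≥ 1` window leaves the levels `k ≥ 2` to the mercy of `β_m 1`).

HONEST SCOPE (A6, №189).  Elementary induction ∕ filter bookkeeping; S2 (K2⁷ line 2's registered stub text, spelled out per `(F, θ, hP)`) is a DISPLAYED HYPOTHESIS — an analytic
statement about Bałaban's merged β-functions ([I] (2.13) p. 268 scale by scale) that the tree does NOT prove (NODE O); nothing discharged; NOT a proof of `stub_anchor13`; K1⁷ ∕ K2⁷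
NOT closed; N13 ∕ N25 ∕ N26 NOT discharged; no stub closed; counts unmoved (typed 28∕28 · discharged 5∕27 · A 5∕28).  One finite four-torus programme at fixed `ε = L^{−K}`, Bałaban AS
PRINTED; the YM mass gap (Clay) is NOT proved by any of this — R4 closes the conditional finite-𝕋⁴ rung `BalabanLadder.UV` only; nothing continuum ∕ ℝ⁴ ∕ OS.  No `def`, no `instance`,
no `notation`, no `axiom`.
References: [I] = [Balaban1987RG1] CMP **109** (1987): (0.17)–(0.20) pp. 255–256, Thm 2 p. 259, (1.20)–(1.22) p. 264, (2.12)–(2.14) p. 268; [B16] = [Balaban1989LargeFieldII]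
CMP **122** (1989): Thm 1 + (0.1) pp. 355–356.
-/

noncomputable section

open scoped Matrix.Norms.L2Operator

namespace Summit.QuantumFields.YangMills.Theorems.BalabanUVNodesK1WindowKOfAnchor

open Literature.MathematicalPhysics.QuantumFieldTheory.Balaban1983to89
open Literature.MathematicalPhysics.QuantumFieldTheory.Balaban1983to89.FlowStep
open Literature.MathematicalPhysics.QuantumFieldTheory.Balaban1983to89.FlowStepRuns
open Literature.MathematicalPhysics.QuantumFieldTheory.Balaban1983to89.DagBinding
open Literature.MathematicalPhysics.QuantumFieldTheory.Balaban1983to89.T4Continuum (T4Family FiniteEpsData)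
open Literature.MathematicalPhysics.QuantumFieldTheory.Balaban1983to89.Node00
open Summit.QuantumFields.YangMills.Theorems.BalabanUVNodesK1WindowFirstStep
open Summit.QuantumFields.YangMills.Theorems.BalabanUVNodesN13WindowAtRecord13SepCoPH
open Summit.QuantumFields.YangMills.Theorems.BalabanUVNodesK1WindowExactCriterion
open Summit.QuantumFields.YangMills.Theorems.BalabanUVNodesK1WindowSharpness
open Filter Topology

/-! ## §1. Flow side: the levels `k < K` suffice; local box bounds suffice for each `K`; the per-scale anchor supplies them -/

section Flow

/-- Elementary: for positive `g`, `γ`, `γ⁻² ≤ g⁻²` gives `g ≤ γ`. [folklore] -/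
private theorem A_le_of_one_div_sq_le {g γ : ℝ} (hg : 0 < g) (hγ : 0 < γ) (h : 1 / γ ^ 2 ≤ 1 / g ^ 2) : g ≤ γ := by
  have h2 : g ^ 2 ≤ γ ^ 2 := (one_div_le_one_div (pow_pos hγ 2) (pow_pos hg 2)).1 h
  nlinarith [h2, hg, hγ]

/-- ★ **THE LADDER WITH THE UPPER BOUND ASKED ONLY AT THE LEVELS `1 ≤ k < K`** (`…K1WindowSharpness.ladder_…_succ` reads no other level): forward-generated `C`, `β k ≤ β⁺` on
`]0, γ₀]^{k+1}` for `1 ≤ k < K`, bare coupling `g₀ ∈ ]0, γ]`, `γ ≤ γ₀`, first-step gap `γ⁻² + K·max(β⁺,0) ≤ g₀⁻² − β 0 (g₀)` ⟹ along `⟨K, m, g₀⟩` all couplings in `]0, γ]` and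
`γ⁻² + (K − i)·max(β⁺,0) ≤ g_i⁻²` for `1 ≤ i ≤ K`. [cite: Balaban1987RG1, (0.18)–(0.20) pp.255–256 and §1 p.264 (elementary consequence)] -/
theorem ladder_of_forwardGenerated_of_firstStepGap_of_betaUpper_lt (C : B12.Construction) (β : HBeta) (hgen : ForwardGenerated C β) {βup γ₀ γ g₀ : ℝ} (m K : ℕ)
    (hhi : ∀ k : ℕ, 1 ≤ k → k < K → ∀ v, v ∈ Box γ₀ k → β k v ≤ βup) (hγ : 0 < γ) (hγ₀ : γ ≤ γ₀) (hg₀ : 0 < g₀) (hg₀γ : g₀ ≤ γ)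
    (hgap : 1 / γ ^ 2 + (K : ℝ) * max βup 0 ≤ 1 / g₀ ^ 2 - β 0 (fun _ => g₀)) :
    ∀ k, k ≤ K → ∀ i, i ≤ k →
      (0 < (C ⟨K, m, g₀⟩).flow.g i ∧ (C ⟨K, m, g₀⟩).flow.g i ≤ γ) ∧
        (1 ≤ i → 1 / γ ^ 2 + ((K : ℝ) - i) * max βup 0 ≤ 1 / ((C ⟨K, m, g₀⟩).flow.g i) ^ 2) := by
  set B : ℝ := max βup 0 with hBdef
  have hB0 : 0 ≤ B := le_max_right _ _
  have hBup : βup ≤ B := le_max_left _ _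
  have hγ2 : 0 < 1 / γ ^ 2 := by positivity
  set P : B12.RunParams := ⟨K, m, g₀⟩ with hPdef
  have hg0 : (C P).flow.g 0 = g₀ := hgen.1 P
  have hleγ : ∀ i : ℕ, i ≤ K → 0 < (C P).flow.g i → 1 / γ ^ 2 + ((K : ℝ) - i) * B ≤ 1 / ((C P).flow.g i) ^ 2 → (C P).flow.g i ≤ γ := by
    intro i hi hpos hb
    have hle : 1 / γ ^ 2 ≤ 1 / ((C P).flow.g i) ^ 2 :=
      le_trans (le_add_of_nonneg_right (mul_nonneg (sub_nonneg.mpr (by exact_mod_cast hi)) hB0)) hb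
    exact A_le_of_one_div_sq_le hpos hγ hle
  intro k
  induction k with
  | zero =>
    intro _ i hi
    obtain rfl : i = 0 := Nat.le_zero.mp hi
    rw [hg0]
    exact ⟨⟨hg₀, hg₀γ⟩, fun h => absurd h (by norm_num)⟩
  | succ k ih =>
    intro hk i hi
    have ih' := ih (Nat.le_of_succ_le hk)
    rcases Nat.lt_or_ge i (k + 1) with hlt | hge
    · exact ih' i (Nat.lt_succ_iff.mp hlt)
    · obtain rfl : i = k + 1 := le_antisymm hi hge
      have hkK : k < K := Nat.lt_of_succ_le hk
      have hpos : ∀ j, j ≤ k → 0 < (C P).flow.g j := fun j hj => (ih' j hj).1.1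
      have hrhs_ge : 1 / γ ^ 2 + ((K : ℝ) - (k + 1 : ℕ)) * B ≤ 1 / ((C P).flow.g k) ^ 2 - β k (prefixOf (C P).flow.g k) := by
        rcases Nat.eq_zero_or_pos k with rfl | hk1
        · have hpre : prefixOf (C P).flow.g 0 = fun _ => g₀ := by
            funext j
            rw [Subsingleton.elim (α := Fin 1) j 0]
            exact hg0
          rw [hpre, hg0]
          have : ((K : ℝ) - (0 + 1 : ℕ)) * B ≤ (K : ℝ) * B := by
            apply mul_le_mul_of_nonneg_right _ hB0
            push_cast; linarith
          linarith
        · have hbox : prefixOf (C P).flow.g k ∈ Box γ₀ k := by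
            rw [mem_box]
            intro j
            have hj : (j : ℕ) ≤ k := Nat.lt_succ_iff.mp j.isLt
            exact ⟨hpos j hj, ((ih' j hj).1.2).trans hγ₀⟩
          have hβle : β k (prefixOf (C P).flow.g k) ≤ B := (hhi k hk1 hkK _ hbox).trans hBup
          have hbk : 1 / γ ^ 2 + ((K : ℝ) - k) * B ≤ 1 / ((C P).flow.g k) ^ 2 := (ih' k le_rfl).2 hk1
          have : ((K : ℝ) - (k + 1 : ℕ)) * B = ((K : ℝ) - k) * B - B := by push_cast; ring
          rw [this]
          linarith
      have hKk : (0 : ℝ) ≤ (K : ℝ) - (k + 1 : ℕ) := by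
        have : (k + 1 : ℕ) ≤ K := hk
        exact sub_nonneg.mpr (by exact_mod_cast this)
      have hrhs : 0 < 1 / ((C P).flow.g k) ^ 2 - β k (prefixOf (C P).flow.g k) :=
        lt_of_lt_of_le (by positivity) hrhs_ge
      obtain ⟨hposk1, heq⟩ := hgen.2 P k hkK hpos hrhs
      have hb : 1 / γ ^ 2 + ((K : ℝ) - (k + 1 : ℕ)) * B ≤ 1 / ((C P).flow.g (k + 1)) ^ 2 := by rw [heq]; exact hrhs_ge
      exact ⟨⟨hposk1, hleγ (k + 1) hk hposk1 hb⟩, fun _ => hb⟩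

/-- ★ **RUNS OF LENGTH `K` FROM THE EXACT LEVEL-0 CRITERION AND THE UPPER BOX BOUND AT THE LEVELS `1 ≤ k < K` ONLY** (forward-generated `C`; every `γ ∈ ]0, γ₀]`, every `m`).
[cite: Balaban1987RG1, (0.18)–(0.20) pp.255–256 and §1 p.264 (elementary consequence)] -/
theorem windowK_of_forwardGenerated_of_frequently_le_of_betaUpper_lt (C : B12.Construction) (β : HBeta) (hgen : ForwardGenerated C β) {βup γ₀ γ : ℝ} (m K : ℕ)
    (h0 : ∀ M : ℝ, ∃ᶠ x in 𝓝[>] (0 : ℝ), M ≤ 1 / x ^ 2 - β 0 (fun _ => x))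
    (hhi : ∀ k : ℕ, 1 ≤ k → k < K → ∀ v, v ∈ Box γ₀ k → β k v ≤ βup) (hγ : 0 < γ) (hγ₀ : γ ≤ γ₀) :
    ∃ g0 : ℝ, 0 < g0 ∧ (C ⟨K, m, g0⟩).flow.InInterval γ K := by
  have hlt : ∀ᶠ x in 𝓝[>] (0 : ℝ), x < γ := (eventually_lt_nhds hγ).filter_mono nhdsWithin_le_nhds
  have hpos : ∀ᶠ x in 𝓝[>] (0 : ℝ), 0 < x := eventually_mem_nhdsWithin
  obtain ⟨g₀, hgap, hg₀lt, hg₀⟩ := ((h0 (1 / γ ^ 2 + (K : ℝ) * max βup 0)).and_eventually (hlt.and hpos)).exists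
  refine ⟨g₀, hg₀, fun k hk => ?_⟩
  exact (ladder_of_forwardGenerated_of_firstStepGap_of_betaUpper_lt C β hgen m K hhi hγ hγ₀ hg₀ hg₀lt.le hgap k hk k le_rfl).1

/-- **FINITELY MANY LOCAL BOX BOUNDS GIVE ONE BOX AND ONE CONSTANT BELOW `K`**: if every `β k`, `k ≥ 1`, is bounded above by `B k` on SOME box `]0, γ_k]^{k+1}` (radius depending on
`k`), then for every `K` there are `γ_K > 0` and `β⁺` with `β k ≤ β⁺` on `]0, γ_K]^{k+1}` for all `1 ≤ k < K` (a finite minimum of radii, a finite maximum of constants; `K ≤ 1`: vacuous).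
[folklore] -/
theorem exists_common_box_upTo (β : HBeta) (hloc : ∀ k : ℕ, 1 ≤ k → ∃ γk : ℝ, 0 < γk ∧ ∃ Bk : ℝ, ∀ v, v ∈ Box γk k → β k v ≤ Bk) :
    ∀ K : ℕ, ∃ γK : ℝ, 0 < γK ∧ ∃ βup : ℝ, ∀ k : ℕ, 1 ≤ k → k < K → ∀ v, v ∈ Box γK k → β k v ≤ βup := by
  intro K
  induction K with
  | zero => exact ⟨1, one_pos, 0, fun k _ hk => absurd hk (Nat.not_lt_zero k)⟩
  | succ K ih =>
    obtain ⟨γK, hγK, βup, hK⟩ := ih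
    rcases Nat.eq_zero_or_pos K with rfl | hK1
    · -- `K + 1 = 1`: no level `1 ≤ k < 1`
      exact ⟨1, one_pos, 0, fun k hk1 hk => absurd (lt_of_le_of_lt hk1 hk) (lt_irrefl 1)⟩
    · obtain ⟨γk, hγk, Bk, hBk⟩ := hloc K hK1
      refine ⟨min γK γk, lt_min hγK hγk, max βup Bk, fun k hk1 hk v hv => ?_⟩
      rcases Nat.lt_or_ge k K with hlt | hge
      · exact (hK k hk1 hlt v (box_mono (min_le_left _ _) k hv)).trans (le_max_left _ _)
      · obtain rfl : k = K := le_antisymm (Nat.lt_succ_iff.mp hk) hge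
        exact (hBk v (box_mono (min_le_right _ _) k hv)).trans (le_max_right _ _)

/-- ★★ **RUNS OF EVERY LENGTH, EACH IN ITS OWN WINDOW, FROM LOCAL DATA**: forward-generated `C`, the exact level-0 criterion, and for every `k ≥ 1` an upper bound for `β k` on SOME
box near the corner ⟹ for every `K` there is `γ_K > 0` such that every `γ ∈ ]0, γ_K]` and every `m` admit `g₀ > 0` with the run `⟨K, m, g₀⟩` inside `]0, γ]`.  (The window radius
depends on `K`; uniformity in `K` is what a UNIFORM box bound — [I] p. 264 — adds: `…K1WindowSharpness.windowK_…_succ`.)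
[cite: Balaban1987RG1, (0.18)–(0.20) pp.255–256, Thm 2 p.259 and §1 p.264 (elementary consequence)] -/
theorem windowK_local_of_forwardGenerated_of_frequently_le (C : B12.Construction) (β : HBeta) (hgen : ForwardGenerated C β)
    (h0 : ∀ M : ℝ, ∃ᶠ x in 𝓝[>] (0 : ℝ), M ≤ 1 / x ^ 2 - β 0 (fun _ => x))
    (hloc : ∀ k : ℕ, 1 ≤ k → ∃ γk : ℝ, 0 < γk ∧ ∃ Bk : ℝ, ∀ v, v ∈ Box γk k → β k v ≤ Bk) (K m : ℕ) :
    ∃ γK : ℝ, 0 < γK ∧ ∀ γ : ℝ, 0 < γ → γ ≤ γK → ∃ g0 : ℝ, 0 < g0 ∧ (C ⟨K, m, g0⟩).flow.InInterval γ K := by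
  obtain ⟨γK, hγK, βup, hK⟩ := exists_common_box_upTo β hloc K
  exact ⟨γK, hγK, fun γ hγ hγle => windowK_of_forwardGenerated_of_frequently_le_of_betaUpper_lt C β hgen m K h0 hK hγ hγle⟩

/-- **THE PER-SCALE ANCHOR AT SCALE `k` GIVES A LOCAL UPPER BOUND NEAR THE CORNER** (`0 < γθ`): for the definitional split of `betaOfMerged βm β0 γθ`, «∀ δ > 0, ∃ γ > 0,
∀ v ∈ ]0,γ]^{k+1}, |S.β1 k v| ≤ δ» ⟹ `βm k ≤ β0 k + 1` on some box `]0, γ]^{k+1}` (take `δ := 1`, shrink below `γθ` so that the remainder IS `βm k − β0 k`).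
[cite: Balaban1987RG1, (2.12)–(2.14) p.268 (elementary consequence)] -/
theorem localUpper_of_anchorAt_betaOfMerged (βm : HBeta) (β0 : ℕ → ℝ) {γθ : ℝ} (hγθ : 0 < γθ) (k : ℕ)
    (hA : ∀ δ : ℝ, 0 < δ → ∃ γ : ℝ, 0 < γ ∧ ∀ v ∈ Box γ k, |(oneLoopSplit_betaOfMerged βm β0 γθ).β1 k v| ≤ δ) :
    ∃ γk : ℝ, 0 < γk ∧ ∃ Bk : ℝ, ∀ v, v ∈ Box γk k → βm k v ≤ Bk := by
  obtain ⟨γ, hγ, h⟩ := hA 1 one_pos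
  refine ⟨min γ γθ, lt_min hγ hγθ, β0 k + 1, fun v hv => ?_⟩
  have hvγ : v ∈ Box γ k := box_mono (min_le_left _ _) k hv
  have hvθ : v ∈ Box γθ k := box_mono (min_le_right _ _) k hv
  have hb := h v hvγ
  have hface : (oneLoopSplit_betaOfMerged βm β0 γθ).β1 k v = (Box γθ k).indicator (fun w => βm k w - β0 k) v := rfl
  rw [hface, Set.indicator_of_mem hvθ] at hb
  linarith [(abs_le.mp hb).2]

/-- **THE ANCHOR AT SCALE `0` GIVES THE EXACT LEVEL-0 CRITERION** (`0 < γθ`): the merged first β-function is then bounded above near `0⁺` (by `β0 0 + 1`), in particular FREQUENTLY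
bounded above, whence `∀ M, ∃ᶠ g in 𝓝[>] 0, M ≤ g⁻² − βm 0 (g)` (`…K1WindowExactCriterion.firstStep_of_frequently_beta_le` + `firstStep_iff_frequently_le`).
[cite: Balaban1987RG1, (2.12)–(2.14) p.268 and (0.18)–(0.20) pp.255–256 (elementary consequence)] -/
theorem frequently_le_of_anchorZero_betaOfMerged (βm : HBeta) (β0 : ℕ → ℝ) {γθ : ℝ} (hγθ : 0 < γθ)
    (hA : ∀ δ : ℝ, 0 < δ → ∃ γ : ℝ, 0 < γ ∧ ∀ v ∈ Box γ 0, |(oneLoopSplit_betaOfMerged βm β0 γθ).β1 0 v| ≤ δ) :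
    ∀ M : ℝ, ∃ᶠ x in 𝓝[>] (0 : ℝ), M ≤ 1 / x ^ 2 - βm 0 (fun _ => x) := by
  obtain ⟨γ0, hγ0, B0, hB0⟩ := localUpper_of_anchorAt_betaOfMerged βm β0 hγθ 0 hA
  refine (firstStep_iff_frequently_le βm).mp (firstStep_of_frequently_beta_le βm ⟨B0, ?_⟩)
  have hlt : ∀ᶠ x in 𝓝[>] (0 : ℝ), x < γ0 := (eventually_lt_nhds hγ0).filter_mono nhdsWithin_le_nhds
  have hpos : ∀ᶠ x in 𝓝[>] (0 : ℝ), 0 < x := eventually_mem_nhdsWithin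
  refine Filter.Eventually.frequently ?_
  filter_upwards [hlt, hpos] with x hx hx0
  exact hB0 (fun _ => x) (const_mem_box_zero_iff.mpr ⟨hx0, hx.le⟩)

/-- ★★ **THE PER-SCALE ANCHOR ALONE GIVES RUNS OF EVERY LENGTH, EACH LENGTH IN ITS OWN WINDOW** (forward-generated `C` whose history family is `betaOfMerged βm β0 γθ`, `0 < γθ`):
«∀ k δ > 0, ∃ γ > 0, |S.β1 k v| ≤ δ on ]0,γ]^{k+1}» ⟹ ∀ K m, ∃ γ_K > 0, ∀ γ ∈ ]0, γ_K], ∃ g₀ > 0, the run `⟨K, m, g₀⟩` lies in `]0, γ]` (level `0`: the exact criterion from S2_0;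
levels `1 ≤ k < K`: local bounds from S2_k, merged into one box; on boxes below `γθ` the history family IS `βm`). [cite: Balaban1987RG1, (2.12)–(2.14) p.268, (0.18)–(0.20) pp.255–256 and Thm 2 p.259 (elementary consequence)] -/
theorem windowK_of_forwardGenerated_of_anchor_betaOfMerged (C : B12.Construction) (βm : HBeta) (β0 : ℕ → ℝ) {γθ : ℝ} (hγθ : 0 < γθ)
    (hgen : ForwardGenerated C (betaOfMerged βm β0 γθ))
    (hA : ∀ k : ℕ, ∀ δ : ℝ, 0 < δ → ∃ γ : ℝ, 0 < γ ∧ ∀ v ∈ Box γ k, |(oneLoopSplit_betaOfMerged βm β0 γθ).β1 k v| ≤ δ) (K m : ℕ) :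
    ∃ γK : ℝ, 0 < γK ∧ ∀ γ : ℝ, 0 < γ → γ ≤ γK → ∃ g0 : ℝ, 0 < g0 ∧ (C ⟨K, m, g0⟩).flow.InInterval γ K := by
  -- level 0: the exact criterion for `βm`, transported to `betaOfMerged βm β0 γθ` (equal near `0⁺`)
  have h0m := frequently_le_of_anchorZero_betaOfMerged βm β0 hγθ (hA 0)
  have h0 : ∀ M : ℝ, ∃ᶠ x in 𝓝[>] (0 : ℝ), M ≤ 1 / x ^ 2 - betaOfMerged βm β0 γθ 0 (fun _ => x) := by
    intro M
    have hlt : ∀ᶠ x in 𝓝[>] (0 : ℝ), x < γθ := (eventually_lt_nhds hγθ).filter_mono nhdsWithin_le_nhds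
    have hpos : ∀ᶠ x in 𝓝[>] (0 : ℝ), 0 < x := eventually_mem_nhdsWithin
    refine (h0m M).mp ?_
    filter_upwards [hlt, hpos] with x hx hx0 hM
    rwa [betaOfMerged_of_mem βm β0 γθ (const_mem_box_zero_iff.mpr ⟨hx0, hx.le⟩)]
  -- levels ≥ 1: local bounds for `βm`, hence for `betaOfMerged βm β0 γθ` on boxes below `γθ`
  have hloc : ∀ k : ℕ, 1 ≤ k → ∃ γk : ℝ, 0 < γk ∧ ∃ Bk : ℝ, ∀ v, v ∈ Box γk k → betaOfMerged βm β0 γθ k v ≤ Bk := by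
    intro k _
    obtain ⟨γk, hγk, Bk, hBk⟩ := localUpper_of_anchorAt_betaOfMerged βm β0 hγθ k (hA k)
    refine ⟨min γk γθ, lt_min hγk hγθ, Bk, fun v hv => ?_⟩
    rw [betaOfMerged_of_mem βm β0 γθ (box_mono (min_le_right _ _) k hv)]
    exact hBk v (box_mono (min_le_left _ _) k hv)
  exact windowK_local_of_forwardGenerated_of_frequently_le C (betaOfMerged βm β0 γθ) hgen h0 hloc K m

end Flow

/-! ## §2. At NODE 00's Stage-13 datum: K2⁷ LINE 2's S2 alone gives runs of every length (each length in its own window), in particular K1⁷'s window conjunct -/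

section Record

variable {F : T4Family} {N : ℕ} [NeZero N]

/-- ★★ **S2 ALONE ⟹ RUNS OF EVERY LENGTH AT THE STAGE-13 DATUM** (`0 < θ.γ`; every proviso witness `h`): the per-`(F, θ, h)` body of K2⁷ v4 LINE 2's `D4AnchorRecord13`
(«∀ k δ > 0, ∃ γ > 0, ∀ v ∈ ]0,γ]^{k+1}, |S.β1 k v| ≤ δ» for the record's definitional split, spelled out) ⟹ ∀ K m, ∃ γ_K > 0, ∀ γ ∈ ]0, γ_K], ∃ g₀ > 0,
`((datumOfRecord₁₃SepCoPH F N θ h).C ⟨K, m, g₀⟩).flow.InInterval γ K` (the datum's flow is forward-generated by its β of record = `betaOfMerged β_m β⁰ θ.γ`, def-T `rfl` faces).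
DISPLAYED hypothesis, NOT discharged; NOT a proof of `stub_anchor13`. [cite: Balaban1987RG1, (2.12)–(2.14) p.268, (0.17)–(0.20) pp.255–256 and Thm 2 p.259; Balaban1989LargeFieldII, Thm 1 + (0.1) pp.355–356 (bookkeeping + elementary)] -/
theorem windowK_datumOfRecord₁₃SepCoPH_of_anchor (θ : Stage13HParams F N) (h : θ.Provisos₁₃SepCoPH F N) (hγθ : 0 < θ.γ)
    (hA : letI := θ.instVβ₁; letI := θ.instVβ₂; letI := θ.instιβ
      ∀ k : ℕ, ∀ δ : ℝ, 0 < δ → ∃ γ : ℝ, 0 < γ ∧ ∀ v ∈ Box γ k,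
        |(oneLoopSplit_betaOfMerged (betaMerged F (mergedTermFamilyMatT F N (TcanOfRecord F N) (chiFixed29 F N θ.ν θ.ε₂₉) θ.εbg) θ.ρ8 θ.bV)
            (beta0OfMerged (betaMerged F (mergedTermFamilyMatT F N (TcanOfRecord F N) (chiFixed29 F N θ.ν θ.ε₂₉) θ.εbg) θ.ρ8 θ.bV) θ.v₀) θ.γ).β1 k v| ≤ δ)
    (K m : ℕ) :
    ∃ γK : ℝ, 0 < γK ∧ ∀ γ : ℝ, 0 < γ → γ ≤ γK → ∃ g0 : ℝ, 0 < g0 ∧ ((datumOfRecord₁₃SepCoPH F N θ h).C ⟨K, m, g0⟩).flow.InInterval γ K := by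
  letI := θ.instVβ₁; letI := θ.instVβ₂; letI := θ.instιβ
  exact windowK_of_forwardGenerated_of_anchor_betaOfMerged (datumOfRecord₁₃SepCoPH F N θ h).C.toB12 _ _ hγθ (datumOfRecord₁₃SepCoPH F N θ h).fwd hA K m

/-- **In particular S2 ⟹ K1⁷'s window conjunct** (`K = 1`; = g0's `window_datumOfRecord₁₃SepCoPH_of_anchorZero`, which reads S2 at `k = 0` only — re-derived through the ladder).
[cite: Balaban1987RG1, (2.12)–(2.14) p.268 and (0.17)–(0.20) pp.255–256; Balaban1989LargeFieldII, Thm 1 + (0.1) pp.355–356 (bookkeeping)] -/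
theorem window_datumOfRecord₁₃SepCoPH_of_anchor (θ : Stage13HParams F N) (h : θ.Provisos₁₃SepCoPH F N) (hγθ : 0 < θ.γ)
    (hA : letI := θ.instVβ₁; letI := θ.instVβ₂; letI := θ.instιβ
      ∀ k : ℕ, ∀ δ : ℝ, 0 < δ → ∃ γ : ℝ, 0 < γ ∧ ∀ v ∈ Box γ k,
        |(oneLoopSplit_betaOfMerged (betaMerged F (mergedTermFamilyMatT F N (TcanOfRecord F N) (chiFixed29 F N θ.ν θ.ε₂₉) θ.εbg) θ.ρ8 θ.bV)
            (beta0OfMerged (betaMerged F (mergedTermFamilyMatT F N (TcanOfRecord F N) (chiFixed29 F N θ.ν θ.ε₂₉) θ.εbg) θ.ρ8 θ.bV) θ.v₀) θ.γ).β1 k v| ≤ δ) :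
    ∃ γ₁ : ℝ, 0 < γ₁ ∧ ∀ γ : ℝ, 0 < γ → γ ≤ γ₁ →
      ∃ P : B12.RunParams, 1 ≤ P.K ∧ ((datumOfRecord₁₃SepCoPH F N θ h).C P).flow.InInterval γ P.K := by
  obtain ⟨γ₁, hγ₁, hK⟩ := windowK_datumOfRecord₁₃SepCoPH_of_anchor θ h hγθ hA 1 0
  refine ⟨γ₁, hγ₁, fun γ hγ hγle => ?_⟩
  obtain ⟨g0, -, hI⟩ := hK γ hγ hγle
  exact ⟨⟨1, 0, g0⟩, le_rfl, hI⟩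

end Record

/-! ## §3. `N = 2` (K2⁷ v4's S2 text per `(F, θ, hP)`, keyed on the item's `θ.Admissible F 2`) -/

section Two

variable {F : T4Family}

/-- `N = 2`: at an admissible `(θ, hP)` satisfying the per-tuple body of `D4AnchorRecord13`, runs of EVERY length exist at the Stage-13 datum, each length in its own window.
NOT a proof of `stub_anchor13`; its text is the hypothesis. [cite: Balaban1987RG1, (2.12)–(2.14) p.268 and Thm 2 p.259; Balaban1989LargeFieldII, Thm 1 + (0.1) pp.355–356 (bookkeeping)] -/
theorem windowK₂_datumOfRecord₁₃SepCoPH_of_anchor (θ : Stage13HParams F 2) (hP : θ.Provisos₁₃SepCoPH F 2) (hθ : θ.Admissible F 2)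
    (hA : letI := θ.instVβ₁; letI := θ.instVβ₂; letI := θ.instιβ
      ∀ k : ℕ, ∀ δ : ℝ, 0 < δ → ∃ γ : ℝ, 0 < γ ∧ ∀ v ∈ Box γ k,
        |(oneLoopSplit_betaOfMerged (betaMerged F (mergedTermFamilyMatT F 2 (TcanOfRecord F 2) (chiFixed29 F 2 θ.ν θ.ε₂₉) θ.εbg) θ.ρ8 θ.bV)
            (beta0OfMerged (betaMerged F (mergedTermFamilyMatT F 2 (TcanOfRecord F 2) (chiFixed29 F 2 θ.ν θ.ε₂₉) θ.εbg) θ.ρ8 θ.bV) θ.v₀) θ.γ).β1 k v| ≤ δ)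
    (K m : ℕ) :
    ∃ γK : ℝ, 0 < γK ∧ ∀ γ : ℝ, 0 < γ → γ ≤ γK → ∃ g0 : ℝ, 0 < g0 ∧
      ((Literature.MathematicalPhysics.QuantumFieldTheory.Balaban1983to89.Node00.datumOfRecord₁₃SepCoPH F 2 θ hP).C ⟨K, m, g0⟩).flow.InInterval γ K :=
  windowK_datumOfRecord₁₃SepCoPH_of_anchor θ hP hθ.toStage9.gamma_pos hA K m

end Two

/-! ## §4. Under K-indexed windows (B) bites at EVERY level; with S2 at the record no level of (B) is vacuous -/

section BiteK

/-- ★ **(B) BITES ON RUNS OF EVERY PRESCRIBED LENGTH** (every `C : B16.Construction`): [III]'s end statement (B) as printed + «for every `K`, `m` a window `]0, γ_K]` all of whose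
`γ` carry a run `⟨K, m, g₀⟩` inside `]0, γ]`» ⟹ level-independent `e_±` such that for every `K`, `m` there is `γ_K' > 0` with: for every `γ ∈ ]0, γ_K']` some run of length EXACTLY `K`
lies in `]0, γ]` AND carries `Sect2Form k` at every `k ≤ K` AND `UVIneq … (e₋ g_k) (e₊ g_k)` at every `k ≤ K` and every configuration (shrink `γ_K` below Thm 1's and Cor. 3's
constants). [cite: Balaban1989LargeFieldII, Thm 1 + (0.1) pp.355–356; Balaban1988Convergent, Cor. 3 (2.50) p.264 and (0.4) p.235 (bookkeeping)] -/
theorem bitesK_of_endStatementBPrinted_of_windowK (C : B16.Construction) (hB : B16.EndStatementBPrinted C)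
    (hK : ∀ K m : ℕ, ∃ γK : ℝ, 0 < γK ∧ ∀ γ : ℝ, 0 < γ → γ ≤ γK → ∃ g0 : ℝ, 0 < g0 ∧ (C ⟨K, m, g0⟩).flow.InInterval γ K) :
    ∃ em ep : ℝ → ℝ, ∀ K m : ℕ, ∃ γK : ℝ, 0 < γK ∧ ∀ γ : ℝ, 0 < γ → γ ≤ γK → ∃ g0 : ℝ, 0 < g0 ∧ (C ⟨K, m, g0⟩).flow.InInterval γ K ∧
      (∀ k, k ≤ K → (C ⟨K, m, g0⟩).Sect2Form k) ∧
        ∀ k, k ≤ K → ∀ V : (C ⟨K, m, g0⟩).Cfg k,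
          B16.UVIneq (C ⟨K, m, g0⟩) k V (em ((C ⟨K, m, g0⟩).flow.g k)) (ep ((C ⟨K, m, g0⟩).flow.g k)) := by
  obtain ⟨⟨γT, hγT, hT⟩, ⟨γC, hγC, em, ep, hC⟩⟩ := hB
  refine ⟨em, ep, fun K m => ?_⟩
  obtain ⟨γK, hγK, hrun⟩ := hK K m
  refine ⟨min γK (min γT γC), lt_min hγK (lt_min hγT hγC), fun γ hγ hγle => ?_⟩
  obtain ⟨g0, hg0, hI⟩ := hrun γ hγ (hγle.trans (min_le_left _ _))
  have hIT : (C ⟨K, m, g0⟩).flow.InInterval γT K :=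
    B14Cor3.inInterval_of_le hI (hγle.trans ((min_le_right _ _).trans (min_le_left _ _)))
  have hIC : (C ⟨K, m, g0⟩).flow.InInterval γC K :=
    B14Cor3.inInterval_of_le hI (hγle.trans ((min_le_right _ _).trans (min_le_right _ _)))
  exact ⟨g0, hg0, hI, hT ⟨K, m, g0⟩ hIT, hC ⟨K, m, g0⟩ hIC⟩

variable {F : T4Family} {N : ℕ} [NeZero N] in
/-- ★★ **AT THE STAGE-13 DATUM, (B) ∧ S2 ⟹ (B) BITES AT EVERY LEVEL** (`0 < θ.γ`): [III]'s end statement (B) at `(datumOfRecord₁₃SepCoPH F N θ h).C` together with K2⁷ LINE 2's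
per-scale anchor S2 (text spelled out; DISPLAYED, not discharged) give level-independent `e_±` and, for every `K`, `m`, a window `]0, γ_K]` in each of whose `γ` some run of length
EXACTLY `K` carries §2's description and (2.50) at EVERY level `k ≤ K` — no level of (B) is vacuous (whereas K1⁷'s bare `K ≥ 1` window guarantees the levels `0, 1` only: a merged
`β_m 1` dominating `g⁻²` would leave every run of length `≥ 2` outside every window).  NOT a proof of `stub_anchor13`; (B) and S2 are hypotheses.
[cite: Balaban1989LargeFieldII, Thm 1 + (0.1) pp.355–356; Balaban1988Convergent, Cor. 3 (2.50) p.264; Balaban1987RG1, (2.12)–(2.14) p.268 and Thm 2 p.259 (bookkeeping)] -/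
theorem bitesK_datumOfRecord₁₃SepCoPH_of_endStatementBPrinted_of_anchor (θ : Stage13HParams F N) (h : θ.Provisos₁₃SepCoPH F N) (hγθ : 0 < θ.γ)
    (hB : B16.EndStatementBPrinted (datumOfRecord₁₃SepCoPH F N θ h).C)
    (hA : letI := θ.instVβ₁; letI := θ.instVβ₂; letI := θ.instιβ
      ∀ k : ℕ, ∀ δ : ℝ, 0 < δ → ∃ γ : ℝ, 0 < γ ∧ ∀ v ∈ Box γ k,
        |(oneLoopSplit_betaOfMerged (betaMerged F (mergedTermFamilyMatT F N (TcanOfRecord F N) (chiFixed29 F N θ.ν θ.ε₂₉) θ.εbg) θ.ρ8 θ.bV)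
            (beta0OfMerged (betaMerged F (mergedTermFamilyMatT F N (TcanOfRecord F N) (chiFixed29 F N θ.ν θ.ε₂₉) θ.εbg) θ.ρ8 θ.bV) θ.v₀) θ.γ).β1 k v| ≤ δ) :
    ∃ em ep : ℝ → ℝ, ∀ K m : ℕ, ∃ γK : ℝ, 0 < γK ∧ ∀ γ : ℝ, 0 < γ → γ ≤ γK → ∃ g0 : ℝ, 0 < g0 ∧
      ((datumOfRecord₁₃SepCoPH F N θ h).C ⟨K, m, g0⟩).flow.InInterval γ K ∧
        (∀ k, k ≤ K → ((datumOfRecord₁₃SepCoPH F N θ h).C ⟨K, m, g0⟩).Sect2Form k) ∧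
          ∀ k, k ≤ K → ∀ V : ((datumOfRecord₁₃SepCoPH F N θ h).C ⟨K, m, g0⟩).Cfg k,
            B16.UVIneq ((datumOfRecord₁₃SepCoPH F N θ h).C ⟨K, m, g0⟩) k V
              (em (((datumOfRecord₁₃SepCoPH F N θ h).C ⟨K, m, g0⟩).flow.g k)) (ep (((datumOfRecord₁₃SepCoPH F N θ h).C ⟨K, m, g0⟩).flow.g k)) :=
  bitesK_of_endStatementBPrinted_of_windowK _ hB (windowK_datumOfRecord₁₃SepCoPH_of_anchor θ h hγθ hA)

end BiteK

end Summit.QuantumFields.YangMills.Theorems.BalabanUVNodesK1WindowKOfAnchor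

end
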